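import Summits.Ventures.CertifiedArithmetic.LowPrec.OptTreeWitness
import Summits.Ventures.CertifiedArithmetic.LowPrec.OptTreeSequential
import Literature.ComputerArithmetic.LangeRump2018.Ufp

/-!
HONEST FRAMING: certified error envelopes and provably optimal rounding/accumulation schemes for
low-precision formats under stated cost models; every table by two implementations; no hardware
or vendor claims.

# Theorem T7 — the tree law for ROUND-TOWARD-ZERO accumulation (opt, generation 7)

Cost model CM-T (a fixed binary summation tree, one rounding per internal node), objective T-poly
(worst relative under-estimation over nonnegative floating-point data), rounding mode
ROUND-TOWARD-ZERO at every node — on nonnegative arguments this is round-down, axiomatised by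
`IsRoundDownNonneg p emin fl` over the model `F(p, emin)` of `JeannerodRump2018` (precision `p`,
gradual underflow, no overflow).  Write `u = 2^-p` and `v = 2u(1-u) = 2u - 2u²` (`rzUnit p`).

* `exists_roundDown`: round-down maps into `F(p, emin)` exist (the hypothesis is not vacuous).
* **T7(a)** (`add_le_one_add_rzUnit_mul_fl`): for floats `a, b ≥ 0`,
  `a + b ≤ (1 + v)·fl(a + b)` — the truncation of a sum of two floats loses at most `v·ufp`, not the
  textbook `2u·ufp`: the last `u`-fraction of an ulp cannot be lost because the smaller operand is
  itself on a grid (`add_sub_fl_le_of_le`).  Sharp: `2^e + (2^e·v) ↦ 2^e`.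
* **T7(b)** (`exact_le_treeM_mul_eval_roundDown`, `exact_sub_eval_le_roundDown`): for every
  summation tree with nonnegative floating-point leaves, `exact ≤ M_t(v)·computed`, i.e. the relative
  under-estimation is at most `1 - 1/M_t(v)` (tree polynomial `treeM` of `OptTreePoly.lean` at `v`).
* **T7(c)** (`witRZ`, `rz_witness_attains`): for every tree `t` the relabelling `witRZ` (spine leaf
  `2^E`, a leaf behind `λ ≥ 1` light edges `(2-2u)·u^λ·2^E`) consists of nonnegative floats and
  under-estimates by EXACTLY `1 - 1/N_t`, `N_t = 1 + (2-2u)(M_t(u) - 1)` (`treeN`), under every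
  round-down map: every addition is a full absorption.  Hence
  `1 - 1/N_t ≤ W_RZ(t) ≤ 1 - 1/M_t(v)` for every tree; the two agree to first order (`2·h₁(t)·u`,
  `h₁` = linear coefficient of `M_t`) and
* **T7(d)** (`treeN_seqTree`, `rz_sequential_law`): they COINCIDE on the sequential (recursive) tree:
  `W_RZ(seq_n) = (n-1)v / (1 + (n-1)v)` exactly, attained, for every `n ≥ 1` and `p ≥ 1`.
* **T7(e)** (`rz_pairwise_minimises`): pairwise (halving) summation minimises both bounds over all
  trees with `n` leaves (Theorem P of `OptTreePairwise.lean` at `v` and at `u`).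
The exact worst case of a general tree is NOT `1 - 1/N_t` (certificate C19: first failure at
`n = 11` leaves); see OPTIMA.md §T, Theorem T7.  New results of this cell; nothing is vendored.
-/

namespace Summit.Ventures.CertifiedArithmetic.LowPrec.Opt

open Literature.ComputerArithmetic.JeannerodRump2018
open Literature.ComputerArithmetic.JeannerodRump2018.SumTree
open Literature.ComputerArithmetic.LangeRump2018 (isFloat_zpow log_ge_of_le)

/-! ## Round-down (= round-toward-zero on nonnegative arguments) -/

/-- `fl` maps into `F(p, emin)` and ROUNDS DOWN every nonnegative argument: `fl t ≤ t` and every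
float below `t` is below `fl t`.  On `[0, ∞)` round-toward-zero and round-down coincide, so every
RZ and every RD map satisfies this (nothing is asked on negative arguments beyond landing in `F`). -/
structure IsRoundDownNonneg (p : ℕ) (emin : ℤ) (fl : ℚ → ℚ) : Prop where
  /-- every value is a float -/
  isFloat : ∀ t : ℚ, IsFloat p emin (fl t)
  /-- on nonnegative arguments the value lies below the argument -/
  fl_le : ∀ t : ℚ, 0 ≤ t → fl t ≤ t
  /-- and dominates every float below the argument -/
  le_fl : ∀ t : ℚ, 0 ≤ t → ∀ f : ℚ, IsFloat p emin f → f ≤ t → f ≤ fl t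

/-- The truncation unit `v = 2u(1-u) = 2u - 2u²`. -/
def rzUnit (p : ℕ) : ℚ := 2 * unitRoundoff p * (1 - unitRoundoff p)

/-- `v = 2u - 2u²`. -/
theorem rzUnit_eq (p : ℕ) : rzUnit p = 2 * unitRoundoff p - 2 * unitRoundoff p ^ 2 := by
  unfold rzUnit; ring

/-- `0 ≤ v`. -/
theorem rzUnit_nonneg (p : ℕ) : 0 ≤ rzUnit p := by
  unfold rzUnit
  have h0 := unitRoundoff_nonneg p
  have h1 := unitRoundoff_le_one p
  have : 0 ≤ 1 - unitRoundoff p := by linarith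
  positivity

/-- `v ≤ 1` (indeed `≤ 1/2`). -/
theorem rzUnit_le_one (p : ℕ) : rzUnit p ≤ 1 := by
  unfold rzUnit
  have h0 := unitRoundoff_nonneg p
  have h1 := unitRoundoff_le_one p
  nlinarith

variable {p : ℕ} {emin : ℤ} {fl : ℚ → ℚ}

/-- A nonnegative float is its own round-down. -/
theorem fl_eq_self_of_roundDown (hfl : IsRoundDownNonneg p emin fl) {f : ℚ} (hf : IsFloat p emin f)
    (hf0 : 0 ≤ f) : fl f = f :=
  le_antisymm (hfl.fl_le f hf0) (hfl.le_fl f hf0 f hf le_rfl)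

/-- (h1) for round-down: `max a b ≤ fl(a+b)` for nonnegative floats (each operand is a float below
the sum). -/
theorem max_le_fl_add_roundDown (hfl : IsRoundDownNonneg p emin fl) {a b : ℚ}
    (ha : IsFloat p emin a) (hb : IsFloat p emin b) (ha0 : 0 ≤ a) (hb0 : 0 ≤ b) :
    max a b ≤ fl (a + b) := by
  have h := hfl.le_fl (a + b) (add_nonneg ha0 hb0)
  exact max_le (h a ha (by linarith)) (h b hb (by linarith))

/-! ## Grid structure of `F` -/

/-- GRANULARITY: a float `x ≥ 2^k` (`k + 1 ≥ p` is not needed) is an integer multiple of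
`2^(k+1-p)`. -/
theorem exists_int_mul_of_le (hp : 1 ≤ p) {x : ℚ} (hx : IsFloat p emin x) {k : ℤ}
    (hk : (2 : ℚ) ^ k ≤ x) : ∃ n : ℤ, x = (n : ℚ) * (2 : ℚ) ^ (k + 1 - p) := by
  rcases lt_or_eq_of_le hk with hlt | heq
  · exact exists_int_mul_of_lt (isFloatU_of_isFloat hx) hlt
  · refine ⟨2 ^ (p - 1), ?_⟩
    rw [← heq]
    have : ((2 ^ (p - 1) : ℤ) : ℚ) = (2 : ℚ) ^ (((p - 1 : ℕ) : ℤ)) := by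
      rw [zpow_natCast]; push_cast; ring
    rw [this, ← zpow_add₀ (by norm_num : (2 : ℚ) ≠ 0)]
    congr 1; omega

/-- NO FLOAT INSIDE A GRID CELL: if `2^(p-1) ≤ M` then a float `< (M+1)·2^g` is `≤ M·2^g`. -/
theorem float_le_of_lt_succ (hp : 1 ≤ p) {f : ℚ} (hf : IsFloat p emin f) {M g : ℤ}
    (hM : (2 : ℤ) ^ (p - 1) ≤ M) (hlt : f < ((M : ℚ) + 1) * (2 : ℚ) ^ g) :
    f ≤ (M : ℚ) * (2 : ℚ) ^ g := by
  have hg : (0 : ℚ) < (2 : ℚ) ^ g := zpow_pos (by norm_num) _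
  have hMq : (2 : ℚ) ^ (p - 1) ≤ (M : ℚ) := by exact_mod_cast hM
  have hM0 : (0 : ℚ) < M := lt_of_lt_of_le (by positivity) hMq
  by_cases hsmall : f < (2 : ℚ) ^ (g + ((p - 1 : ℕ) : ℤ))
  · have : (2 : ℚ) ^ (g + ((p - 1 : ℕ) : ℤ)) = (2 : ℚ) ^ (p - 1) * (2 : ℚ) ^ g := by
      rw [zpow_add₀ (by norm_num : (2 : ℚ) ≠ 0), zpow_natCast]; ring
    rw [this] at hsmall
    nlinarith [mul_le_mul_of_nonneg_right hMq hg.le]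
  · rw [not_lt] at hsmall
    obtain ⟨n, hn⟩ := exists_int_mul_of_le hp hf hsmall
    have he : g + ((p - 1 : ℕ) : ℤ) + 1 - p = g := by omega
    rw [he] at hn
    rw [hn] at hlt ⊢
    have h1 : (n : ℚ) < (M : ℚ) + 1 := lt_of_mul_lt_mul_right hlt hg.le
    have h2 : n < M + 1 := by exact_mod_cast h1
    have h3 : (n : ℚ) ≤ (M : ℚ) := by exact_mod_cast (Int.lt_add_one_iff.mp h2)
    exact mul_le_mul_of_nonneg_right h3 hg.le

/-! ## Round-down maps exist -/

/-- A LARGEST FLOAT BELOW `t ≥ 0` EXISTS in `F(p, emin)` (floats are integer multiples `N·2^emin`;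
maximise over the finitely many `0 ≤ N ≤ ⌈t/2^emin⌉`, `0` being a candidate). -/
theorem exists_roundDown_at (p : ℕ) (emin : ℤ) {t : ℚ} (ht : 0 ≤ t) :
    ∃ f : ℚ, IsFloat p emin f ∧ f ≤ t ∧ ∀ g : ℚ, IsFloat p emin g → g ≤ t → g ≤ f := by
  classical
  set c : ℚ := (2 : ℚ) ^ emin with hc_def
  have hc : 0 < c := zpow_pos (by norm_num) _
  set B : ℤ := ⌈t / c⌉ with hB_def
  set S : Finset ℤ := (Finset.Icc 0 B).filter
    (fun N : ℤ => IsFloat p emin ((N : ℚ) * c) ∧ (N : ℚ) * c ≤ t) with hS_def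
  have h0S : (0 : ℤ) ∈ S := by
    rw [hS_def, Finset.mem_filter, Finset.mem_Icc]
    refine ⟨⟨le_rfl, Int.ceil_nonneg (by positivity)⟩, ?_, by simpa using ht⟩
    simpa using isFloat_zero p emin
  obtain ⟨N₀, hN₀, hmax⟩ := Finset.exists_max_image S (fun N : ℤ => (N : ℚ) * c) ⟨0, h0S⟩
  have hN₀' := (Finset.mem_filter.mp hN₀).2
  refine ⟨(N₀ : ℚ) * c, hN₀'.1, hN₀'.2, fun g hg hgt => ?_⟩
  obtain ⟨N, hN⟩ := hg.exists_int_mul_zpow_emin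
  rw [← hc_def] at hN
  have hN₀0 : (0 : ℚ) ≤ (N₀ : ℚ) * c := by
    have : (0 : ℤ) ≤ N₀ := (Finset.mem_Icc.mp (Finset.mem_filter.mp hN₀).1).1
    have : (0 : ℚ) ≤ N₀ := by exact_mod_cast this
    positivity
  by_cases hN0 : 0 ≤ N
  · have hNB : N ≤ B := by
      have h1 : (N : ℚ) ≤ t / c := by rw [le_div_iff₀ hc, ← hN]; exact hgt
      exact Int.cast_le.mp (le_trans h1 (Int.le_ceil _))
    have hNS : N ∈ S := by
      rw [hS_def, Finset.mem_filter, Finset.mem_Icc]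
      exact ⟨⟨hN0, hNB⟩, hN ▸ hg, hN ▸ hgt⟩
    rw [hN]; exact hmax N hNS
  · have : (N : ℚ) < 0 := by exact_mod_cast (not_le.mp hN0)
    have : (N : ℚ) * c < 0 := mul_neg_of_neg_of_pos this hc
    rw [hN]; linarith

/-- ROUND-DOWN MAPS EXIST: `IsRoundDownNonneg p emin` is satisfiable (any `p`, `emin`). -/
theorem exists_roundDown (p : ℕ) (emin : ℤ) : ∃ fl : ℚ → ℚ, IsRoundDownNonneg p emin fl := by
  classical
  have key : ∀ t : ℚ, ∃ f : ℚ, IsFloat p emin f ∧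
      (0 ≤ t → f ≤ t ∧ ∀ g : ℚ, IsFloat p emin g → g ≤ t → g ≤ f) := by
    intro t
    by_cases ht : 0 ≤ t
    · obtain ⟨f, hf, hft, hmax⟩ := exists_roundDown_at p emin ht
      exact ⟨f, hf, fun _ => ⟨hft, hmax⟩⟩
    · exact ⟨0, isFloat_zero p emin, fun h => absurd h ht⟩
  choose fl hF hrest using key
  exact ⟨fl, ⟨hF, fun t ht => (hrest t ht).1, fun t ht => (hrest t ht).2⟩⟩

/-! ## T7(a): the truncation lemma `a + b ≤ (1 + v)·fl(a + b)` -/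

/-- Core of T7(a), normal range, `b ≤ a`: with `2^k ≤ a + b < 2^(k+1)` the loss `a + b - fl(a+b)` is
at most `(1-u)·2^(k+1-p) = v·2^k`. -/
theorem add_sub_fl_le_of_le (hp : 1 ≤ p) (hfl : IsRoundDownNonneg p emin fl) {a b : ℚ}
    (ha : IsFloat p emin a) (hb : IsFloat p emin b) (hb0 : 0 ≤ b) (hba : b ≤ a)
    (hbig : (2 : ℚ) ^ (emin + p) ≤ a + b) :
    a + b - fl (a + b) ≤ rzUnit p * (2 : ℚ) ^ (Int.log 2 (a + b)) ∧
      (2 : ℚ) ^ (Int.log 2 (a + b)) ≤ fl (a + b) := by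
  have h2 : (2 : ℚ) ≠ 0 := by norm_num
  set t := a + b with ht
  have htpos : 0 < t := lt_of_lt_of_le (zpow_pos (by norm_num) _) hbig
  have ha0 : 0 ≤ a := le_trans hb0 hba
  set k := Int.log 2 t with hk
  have hlow : ((2 : ℕ) : ℚ) ^ k ≤ t := Int.zpow_log_le_self (by norm_num) htpos
  have hup : t < ((2 : ℕ) : ℚ) ^ (k + 1) := Int.lt_zpow_succ_log_self (by norm_num) t
  push_cast at hlow hup
  have hk_ge : emin + p ≤ k := by
    have := log_ge_of_le (p := p) (emin := emin) (t := t) (by rwa [abs_of_pos htpos])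
    rwa [abs_of_pos htpos] at this
  -- the grid unit g = 2^(k+1-2p); c = ulp = 2^p g; half-ulp h = 2^(p-1) g; 2^k = 2^(p-1)·2^p... via zpow
  set g : ℚ := (2 : ℚ) ^ (k + 1 - 2 * p) with hg
  have hgpos : 0 < g := zpow_pos (by norm_num) _
  have hP : (0 : ℚ) < (2 : ℚ) ^ p := by positivity
  have hc : (2 : ℚ) ^ (k + 1 - p) = (2 : ℚ) ^ p * g := by
    rw [hg, ← zpow_natCast, ← zpow_add₀ h2]; congr 1; ring
  have hh : (2 : ℚ) ^ (k - p) = (2 : ℚ) ^ (p - 1) * g := by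
    rw [hg, ← zpow_natCast, ← zpow_add₀ h2]; congr 1; push_cast [Nat.cast_sub hp]; ring
  have h2k : (2 : ℚ) ^ k = (2 : ℚ) ^ (p - 1) * ((2 : ℚ) ^ p * g) := by
    rw [hg, ← zpow_natCast, ← zpow_natCast, ← zpow_add₀ h2, ← zpow_add₀ h2]; congr 1
    push_cast [Nat.cast_sub hp]; ring
  have h2k1 : (2 : ℚ) ^ (k + 1) = (2 : ℚ) ^ p * ((2 : ℚ) ^ p * g) := by
    rw [hg, ← zpow_natCast, ← zpow_add₀ h2, ← zpow_add₀ h2]; congr 1; ring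
  have hPP : (2 : ℚ) ^ p = 2 * (2 : ℚ) ^ (p - 1) := by
    rw [← pow_succ']; congr 1; omega
  -- r = fl t
  have hrF := hfl.isFloat t
  have hr_le := hfl.fl_le t htpos.le
  have hmax := hfl.le_fl t htpos.le
  set r := fl t with hr_def
  have h2kF : IsFloat p emin ((2 : ℚ) ^ k) := isFloat_zpow hp (by omega)
  have hRk : (2 : ℚ) ^ k ≤ r := hmax _ h2kF hlow
  -- r is a multiple of c = 2^(k+1-p)
  obtain ⟨m, hm⟩ := exists_int_mul_of_le hp hrF hRk
  rw [hc] at hm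
  -- loss < c
  have hloss_lt : t - r < (2 : ℚ) ^ p * g := by
    by_contra hcon
    rw [not_lt] at hcon
    have hm_lt : (m : ℚ) < (2 : ℚ) ^ p := by
      have : (m : ℚ) * ((2 : ℚ) ^ p * g) < (2 : ℚ) ^ p * ((2 : ℚ) ^ p * g) := by
        rw [← hm, ← h2k1]; linarith
      exact lt_of_mul_lt_mul_right this (by positivity)
    have hm_lt' : m < (2 ^ p : ℤ) := by exact_mod_cast hm_lt
    rcases lt_or_eq_of_le (Int.add_one_le_iff.mpr hm_lt') with hlt | heq
    · -- (m+1)·c is a float ≤ t, hence ≤ r = m·c: contradiction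
      have hF : IsFloat p emin (((m + 1 : ℤ) : ℚ) * (2 : ℚ) ^ (k + 1 - p)) := by
        refine isFloat_of_int_mul (m + 1) (k + 1 - p) ?_ (by omega)
        have h2kpos : (0 : ℚ) < (2 : ℚ) ^ k := zpow_pos (by norm_num) _
        have hm0 : (0 : ℚ) ≤ m := by
          by_contra hneg
          rw [not_le] at hneg
          have : (m : ℚ) * ((2 : ℚ) ^ p * g) < 0 := mul_neg_of_neg_of_pos hneg (by positivity)
          linarith
        have hm0' : (0 : ℤ) ≤ m := by exact_mod_cast hm0
        rw [abs_of_nonneg (by omega)]; exact hlt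
      have hle : ((m + 1 : ℤ) : ℚ) * (2 : ℚ) ^ (k + 1 - p) ≤ t := by
        rw [hc]; push_cast; nlinarith
      have := hmax _ hF hle
      rw [hc, hm] at this; push_cast at this
      nlinarith
    · -- m + 1 = 2^p: then 2^(k+1) = (m+1)·c ≤ t, contradiction
      have : (2 : ℚ) ^ (k + 1) ≤ t := by
        rw [h2k1]
        have hmq : (m : ℚ) + 1 = (2 : ℚ) ^ p := by exact_mod_cast heq
        nlinarith
      linarith
  -- a is a multiple of h = 2^(k-p)
  have ha_ge : (2 : ℚ) ^ (k - 1) ≤ a := by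
    have : (2 : ℚ) ^ (k - 1) = (2 : ℚ) ^ k / 2 := by
      rw [zpow_sub_one₀ h2]; ring
    rw [this]; linarith
  obtain ⟨ia, hia⟩ := exists_int_mul_of_le hp ha ha_ge
  have hia' : a = (ia : ℚ) * ((2 : ℚ) ^ (p - 1) * g) := by
    rw [hia, ← hh]; congr 1; ring_nf
  have haR : a ≤ r := hmax a ha (by linarith)
  -- the key bound: loss ≤ (2^p - 1)·g
  have hkey : t - r ≤ ((2 : ℚ) ^ p - 1) * g := by
    by_cases hbs : b < (2 : ℚ) ^ (k - p)
    · -- small b: loss ≤ b < h = 2^(p-1) g ≤ (2^p - 1) g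
      rw [hh] at hbs
      have : (2 : ℚ) ^ (p - 1) * g ≤ ((2 : ℚ) ^ p - 1) * g := by
        apply mul_le_mul_of_nonneg_right _ hgpos.le
        have : (1 : ℚ) ≤ (2 : ℚ) ^ (p - 1) := one_le_pow₀ (by norm_num)
        linarith
      linarith
    · -- b ≥ h: b is a multiple of g, so the loss is an integer multiple of g below 2^p g
      rw [not_lt] at hbs
      have hbs' : (2 : ℚ) ^ (k - p) ≤ b := hbs
      obtain ⟨ib, hib⟩ := exists_int_mul_of_le hp hb hbs'
      have hib' : b = (ib : ℚ) * g := by rw [hib, hg]; congr 1; ring_nf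
      -- loss = L·g with L = ia·2^(p-1) + ib - m·2^p
      have hL : t - r = (((ia * 2 ^ (p - 1) + ib - m * 2 ^ p : ℤ)) : ℚ) * g := by
        rw [ht, hia', hib', hm]; push_cast; ring
      have hLlt : (((ia * 2 ^ (p - 1) + ib - m * 2 ^ p : ℤ)) : ℚ) < (2 : ℚ) ^ p := by
        have := hloss_lt; rw [hL] at this
        exact lt_of_mul_lt_mul_right this hgpos.le
      have hLint : (ia * 2 ^ (p - 1) + ib - m * 2 ^ p : ℤ) < (2 ^ p : ℤ) := by exact_mod_cast hLlt
      have hLle : (((ia * 2 ^ (p - 1) + ib - m * 2 ^ p : ℤ)) : ℚ) ≤ (2 : ℚ) ^ p - 1 := by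
        have := Int.le_sub_one_of_lt hLint
        exact_mod_cast this
      rw [hL]; exact mul_le_mul_of_nonneg_right hLle hgpos.le
  -- (2^p - 1)·g = v·2^k
  have hv : ((2 : ℚ) ^ p - 1) * g = rzUnit p * (2 : ℚ) ^ k := by
    unfold rzUnit unitRoundoff
    rw [h2k, hPP]; field_simp
  exact ⟨by rw [← hv]; exact hkey, hRk⟩

/-- **T7(a)** for round-down into `F(p, emin)`: `a + b ≤ (1 + v)·fl(a + b)` for nonnegative floats
`a, b` (exact in the gradual-underflow range). -/
theorem add_le_one_add_rzUnit_mul_fl (hp : 1 ≤ p) (hfl : IsRoundDownNonneg p emin fl) {a b : ℚ}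
    (ha : IsFloat p emin a) (hb : IsFloat p emin b) (ha0 : 0 ≤ a) (hb0 : 0 ≤ b) :
    a + b ≤ (1 + rzUnit p) * fl (a + b) := by
  have hv0 := rzUnit_nonneg p
  by_cases hsmall : |a + b| < (2 : ℚ) ^ (emin + p)
  · have hF := isFloat_add_of_small ha hb hsmall
    rw [fl_eq_self_of_roundDown hfl hF (add_nonneg ha0 hb0)]
    nlinarith [mul_nonneg hv0 (add_nonneg ha0 hb0)]
  · rw [not_lt, abs_of_nonneg (add_nonneg ha0 hb0)] at hsmall
    rcases le_total b a with hba | hab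
    · obtain ⟨h1, h2⟩ := add_sub_fl_le_of_le hp hfl ha hb hb0 hba hsmall
      nlinarith [mul_le_mul_of_nonneg_left h2 hv0]
    · obtain ⟨h1, h2⟩ := add_sub_fl_le_of_le hp hfl hb ha ha0 hab (by rw [add_comm b a]; exact hsmall)
      rw [add_comm b a] at h1 h2
      nlinarith [mul_le_mul_of_nonneg_left h2 hv0]

/-! ## T7(b): the upper bound for every tree -/

/-- **T7(b)**: for round-down (round-toward-zero) accumulation of nonnegative floats and every
summation tree, `exact t ≤ M_t(v)·eval fl t`, `v = 2u - 2u²`. -/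
theorem exact_le_treeM_mul_eval_roundDown (hp : 1 ≤ p) (hfl : IsRoundDownNonneg p emin fl)
    (t : SumTree) (ht : ∀ x ∈ leaves t, IsFloat p emin x ∧ 0 ≤ x) :
    exact t ≤ treeM (rzUnit p) t * eval fl t :=
  (exact_le_treeM_mul_eval (rzUnit_nonneg p) (IsFloat p emin) fl hfl.isFloat
    (fun _ _ ha hb ha0 hb0 => max_le_fl_add_roundDown hfl ha hb ha0 hb0)
    (fun _ _ ha hb ha0 hb0 => add_le_one_add_rzUnit_mul_fl hp hfl ha hb ha0 hb0) t ht).1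

/-- **T7(b)**, relative form: `exact - computed ≤ (1 - 1/M_t(v))·exact`. -/
theorem exact_sub_eval_le_roundDown (hp : 1 ≤ p) (hfl : IsRoundDownNonneg p emin fl)
    (t : SumTree) (ht : ∀ x ∈ leaves t, IsFloat p emin x ∧ 0 ≤ x) :
    exact t - eval fl t ≤ (1 - 1 / treeM (rzUnit p) t) * exact t :=
  exact_sub_eval_le (rzUnit_nonneg p) (IsFloat p emin) fl hfl.isFloat
    (fun _ _ ha hb ha0 hb0 => max_le_fl_add_roundDown hfl ha hb ha0 hb0)
    (fun _ _ ha hb ha0 hb0 => add_le_one_add_rzUnit_mul_fl hp hfl ha hb ha0 hb0) t ht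

/-! ## Statement-style R4 proposition (T7(a)(b)); T7(c)–(e) in `OptTreeRZWitness.lean` -/

/-- THEOREM T7(a)(b) (CM-T, T-poly, round-toward-zero on nonnegative data): round-down maps into
`F(p, emin)` exist, and for every one of them (a) `a + b ≤ (1+v)·fl(a+b)` for nonnegative floats,
(b) every summation tree with nonnegative floating-point leaves satisfies
`exact ≤ M_t(v)·computed`, i.e. under-estimates by at most the fraction `1 - 1/M_t(v)`,
`v = 2u - 2u²`. -/
def R4_TruncationTreeBound : Prop :=
  ∀ (p : ℕ) (emin : ℤ), 1 ≤ p →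
    (∃ fl : ℚ → ℚ, IsRoundDownNonneg p emin fl) ∧
    ∀ fl : ℚ → ℚ, IsRoundDownNonneg p emin fl →
      (∀ a b : ℚ, IsFloat p emin a → IsFloat p emin b → 0 ≤ a → 0 ≤ b →
        a + b ≤ (1 + rzUnit p) * fl (a + b)) ∧
      ∀ t : SumTree, (∀ x ∈ leaves t, IsFloat p emin x ∧ 0 ≤ x) →
        exact t ≤ treeM (rzUnit p) t * eval fl t ∧
        exact t - eval fl t ≤ (1 - 1 / treeM (rzUnit p) t) * exact t

/-- `R4_TruncationTreeBound` holds. -/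
theorem R4_TruncationTreeBound_holds : R4_TruncationTreeBound := by
  intro p emin hp
  refine ⟨exists_roundDown p emin, fun fl hfl => ⟨?_, fun t ht => ⟨?_, ?_⟩⟩⟩
  · exact fun a b ha hb ha0 hb0 => add_le_one_add_rzUnit_mul_fl hp hfl ha hb ha0 hb0
  · exact exact_le_treeM_mul_eval_roundDown hp hfl t ht
  · exact exact_sub_eval_le_roundDown hp hfl t ht

end Summit.Ventures.CertifiedArithmetic.LowPrec.Opt
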